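import Summits.QuantumFields.YangMills.Theorems.BalabanUVNodesPortS1Chart
import Summits.QuantumFields.YangMills.Theorems.BalabanUVNodesN09FlatSectorUniqueness
import Literature.MathematicalPhysics.QuantumFieldTheory.Balaban1983to89.Node00.BetaTransportComparison
import Literature.MathematicalPhysics.QuantumFieldTheory.Balaban1983to89.B15Claim189UnitTestAtRecord
import Literature.MathematicalPhysics.QuantumFieldTheory.Balaban1983to89.T4AdjointCovarianceUnitary
import Literature.MathematicalPhysics.QuantumFieldTheory.Balaban1983to89.B12ContinuousTransportInvarianceOn
import Literature.MathematicalPhysics.QuantumFieldTheory.Balaban1983to89.B15Chi124DetSets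

/-!
# NODE O port PT-A, [RG-I] §2 (2.3) ∕ p. 265 — ROW S2-sel, PART 1: THE ROOTED-GAUGE SELECTOR AT THE UNIT.  `UkSel … 1 = 1` (the (0.21) minimiser of
# record over the trivial coarse field, read in the rooted gauge, IS the unit configuration), hence the charted configuration at `B = 0` has background field
# `U_{k+1}(W_0) = 1` bondwise — the VALUE half of the smallness `‖U_{k+1}(W_B)_b − 1‖ ≤ ½` near `B = 0` that the chart round trip (S1-C) reads

Cell `ym-nodeO-ideate`, porter seat `ymgap-nodeO-port-PTA-1` (gen 0); `--supports stmt-QuantumFields-27930`; PORT-PLAN v1 row S2-sel (PTA-1 share per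
port-lead RULING L-1 (4)).  [I] = [Balaban1987RG1], [15] = [Balaban1985Variational].  Print (2.3) p. 265: «This critical configuration, which is a minimum
of the function (2.2), is denoted by V^{(k)} = V^{(k)}(W), and is related to the minimal configuration U_{k+1}(W) in the axial gauge by the equality
V^{(k)} = Ū^k_{k+1} = M_k(U_{k+1})»; at `W = 1` the minimal orbit is that of the unit ([15] Thm 1 in the flat sector — the tree's
`BalabanUVNodesN09FlatSectorUniqueness`: `uniqueUkOrbit_one`, `isBackground_of_flat`, `flat_one`), and the rooted gauge of the unit is the unit
(`T4RootedResidualGauge.rootGauge_one`), so the CANONICAL selector `UkSel` (`Node00/BackgroundSelOfRecord.rootGauge_eq_UkSel_of_isBackground`) returns `1`.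

CONTENTS.  ★ `UkSel_one` (every `k ≤ m + K`, every radius `ε`); `unitField_zero` (`W_0 = exp(ρ₈ 0) = 1` read through `suOfMat`); ★ `recordBgField_zero`
(`U_{k+1}(W_0) = 1` in the rooted gauge, `k + 1 ≤ m + K`); `recordBgUnits_zero`; `norm_recordBgField_zero_sub_one` (the smallness hypothesis `hU` of
`exp_chartMat(U)_recordEmb(J)` ∕ `decodeCfg_recordChart(J)_recordEmb(J)` holds AT `B = 0` with room `0 ≤ ½`).  PART 2 (next generation) = CONTINUITY of
`B ↦ U_{k+1}(W_B)` at `0` ([15] Thm 1 existence∕uniqueness NEAR the unit + Prop. 9 continuous dependence — hypothesis-level in the tree for `k ≥ 1`), which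
upgrades «at `B = 0`» to «eventually near `B = 0`» as row (f) needs.  The level guard `k + 1 ≤ (F.P K).m + (F.P K).K` is Setup's standing range (the texts'
volumes `recordK₀ F Mc k + n ≥ k + 1`).

HONEST FRAMING.  Bookkeeping on the tree's flat-sector theorems and the selector's canonicity; [15] Thm 1 off the flat sector is NOT proved here or anywhere in the
tree; nothing of Bałaban's estimates asserted, ported or discharged; 27930 OPEN; K0⁷ NOT closed; NODE O 0∕1; COUNT 8∕28 · K 1∕4 UNMOVED; finite `𝕋⁴_{L^K}` at
fixed ε — NOT continuum ∕ OS ∕ Clay; **the Yang–Mills mass gap is NOT proved by any of this.**  No `sorry`, no `def`, no `instance`; standard axioms.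

v2 (porter gen 2, APPEND-ONLY; §1–§2 byte-identical to ✓p795359): §3 = PART 2 as announced — from the SHAPE of the displayed [15] Prop. 9 token TokP9-reg
(CRIT-1 RULING (B) ∕ Q-4: `AnalyticAt ℝ (B ↦ (b, i, i') ↦ (U_{k+1}(W_B)_b)ᵢᵢ') 0`, an ANTECEDENT of 27931⁷ ∕ 27930⁸ — a hypothesis here, not a tree theorem) the
continuity at `0`, the eventual smallness `‖U_{k+1}(W_B)_b − 1‖ ≤ ½` on every bond, the eventual (1.9)-pair decoding of the two-block chart∘embedding, and row (f)
from the (1.7)∕(1.9) identity alone; plus the standing-range arithmetic at the texts' volumes `recordK₀ F Mc k + n`.  Same honest framing.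

v3 (porter gen 2, APPEND-ONLY; §1–§3 byte-identical to ✓p796848): §4 — at the fill `thetaFill` (`ρ₈ = suChartMap 2`, `εbg = a₀`): `W_B(b) = exp(ρ₈ B(b)) ∈ SU(2)`
honestly (`coe_unitField_thetaFill`), `B ↦ W_B` continuous, ★ `eventually_plaqSmall_unitField` (near `B = 0` the charted configuration is small-field) and
★ `eventually_isBackground_recordBgField_of_tokE` (under the displayed TokE shape of ⁸: `U_{k+1}(W_B)` IS a minimiser over `W_B` with unique minimal orbit, eventually).
-/

noncomputable section

open scoped BigOperators Matrix.Norms.L2Operator Topology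

namespace Summit.QuantumFields.YangMills.Theorems.BalabanUVNodesPortS1

open Summit.QuantumFields.YangMills.Theorems.K0RecordFormatNames
open Summit.QuantumFields.YangMills.BalabanUVNodes.N09FlatSectorUniqueness
open Literature.MathematicalPhysics.QuantumFieldTheory.Balaban1983to89
open Literature.MathematicalPhysics.QuantumFieldTheory.Balaban1983to89.Node00
open Literature.MathematicalPhysics.QuantumFieldTheory.Balaban1983to89.T4Continuum (T4Family)
open NormedSpace (exp)

variable (F : T4Family)

/-! ## §1  The rooted-gauge selector at the trivial coarse field -/

/-- **`UkSel … 1 = 1`** — the (0.21) minimiser OF RECORD over the unit coarse field, in the rooted gauge, is the unit configuration: if (0.21) is solvable at `1`,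
the unit fine field is itself a minimiser over `1` (flat sector, action `0`) and the minimal orbit is unique (`uniqueUkOrbit_one`), so the canonical selector
returns `rootGauge k 1 = 1`; if not, the selector's documented default is `1`.  Every level `k ≤ m + K`, every radius.
[cite: Balaban1985Variational, Thm 1 p.279; Balaban1987RG1, (0.21) p.256, (2.3) p.265] -/
theorem UkSel_one {K k : ℕ} (hk : k ≤ (F.P K).m + (F.P K).K) (ε : ℝ) :
    UkSel F 2 K k ε (1 : GaugeField (F.P K) k (SU 2)) = 1 := by
  by_cases h : UkExists F 2 K k ε (1 : GaugeField (F.P K) k (SU 2))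
  · obtain ⟨U₀, hU₀⟩ := h
    have hmem : (1 : GaugeField (F.P K) 0 (SU 2)) ∈ bgReg F 2 K k ε :=
      mem_bgReg_of_flat_of_mem (F := F) (N := 2) (flat_one (P := F.P K) (j := 0)) hU₀.2.1
    have hbg : IsBackground (avOfRecord F 2 K) (bgReg F 2 K k ε) k (1 : GaugeField (F.P K) k (SU 2)) 1 := by
      have h1 := isBackground_of_flat (F := F) (N := 2) (k := k) (flat_one (P := F.P K) (j := 0)) hmem
      rwa [B15Claim189UnitTestAtRecord.iter_avOfRecord_one F 2 K k] at h1
    rw [← rootGauge_eq_UkSel_of_isBackground hk (uniqueUkOrbit_one (F := F) (N := 2) hk ε) hbg,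
      T4RootedResidualGauge.rootGauge_one]
  · exact UkSel_of_not h

/-! ## §2  The charted configuration at `B = 0`: `W_0 = 1`, `U_{k+1}(W_0) = 1` -/

/-- At `B = 0` the charted unit-lattice configuration is the unit: `W_0(b) = exp(ρ₈ 0) = 1` read through `suOfMat`. [cite: Balaban1987RG1, p.264 (before (1.20))] -/
theorem unitField_zero (θ : Stage13Params F 2) (k K : ℕ) :
    letI := θ.instVβ₁; letI := θ.instVβ₂
    unitField F θ k K (0 : Fin (F.P K).d → Site (F.P K) (k + 1) → θ.Vβ) = 1 := by
  letI := θ.instVβ₁; letI := θ.instVβ₂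
  funext b
  show suOfMat 2 (exp (θ.ρ8 ((0 : Fin (F.P K).d → Site (F.P K) (k + 1) → θ.Vβ) b.dir b.src))) = (1 : SU 2)
  rw [Pi.zero_apply, Pi.zero_apply, map_zero, NormedSpace.exp_zero, suOfMat_one 2]

/-- **`U_{k+1}(W_0) = 1` in the rooted gauge** (`k + 1 ≤ m + K`): the record's background field of the charted configuration at `B = 0` is the unit fine field.
[cite: Balaban1987RG1, (2.3) p.265, (0.21) p.256; Balaban1985Variational, Thm 1 p.279] -/
theorem recordBgField_zero (θ : Stage13Params F 2) {k K : ℕ} (hk : k + 1 ≤ (F.P K).m + (F.P K).K) :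
    letI := θ.instVβ₁; letI := θ.instVβ₂
    recordBgField F θ k K (0 : Fin (F.P K).d → Site (F.P K) (k + 1) → θ.Vβ) = 1 := by
  letI := θ.instVβ₁; letI := θ.instVβ₂
  rw [recordBgField, unitField_zero, UkSel_one F hk]

/-- The same through `ιSU`: the units-valued background field at `B = 0` is the constant unit. [cite: Balaban1987RG1, (2.3) p.265 (bookkeeping)] -/
theorem recordBgUnits_zero (θ : Stage13Params F 2) {k K : ℕ} (hk : k + 1 ≤ (F.P K).m + (F.P K).K) :
    letI := θ.instVβ₁; letI := θ.instVβ₂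
    recordBgUnits F θ k K (0 : Fin (F.P K).d → Site (F.P K) (k + 1) → θ.Vβ) = fun _ => 1 := by
  letI := θ.instVβ₁; letI := θ.instVβ₂
  funext b
  rw [recordBgUnits, recordBgField_zero F θ hk]
  exact map_one (ιSU 2)

/-- **The smallness hypothesis of the chart round trip holds AT `B = 0`**: `‖U_{k+1}(W_0)_b − 1‖ = 0 ≤ ½` on every fine bond — so `exp_chartMatU_recordEmbJ` and
`decodeCfg_recordChartJ_recordEmbJ` apply at the chart origin (their «eventually near `0`» form is row S2-sel part 2: continuity of `B ↦ U_{k+1}(W_B)`).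
[cite: Balaban1987RG1, (2.3) p.265, p.258] -/
theorem norm_recordBgField_zero_sub_one (θ : Stage13Params F 2) {k K : ℕ} (hk : k + 1 ≤ (F.P K).m + (F.P K).K) (b : PBond (F.P K) 0) :
    letI := θ.instVβ₁; letI := θ.instVβ₂
    ‖((recordBgField F θ k K (0 : Fin (F.P K).d → Site (F.P K) (k + 1) → θ.Vβ) b : SU 2) : MatA 2) - 1‖ ≤ 1 / 2 := by
  letI := θ.instVβ₁; letI := θ.instVβ₂
  rw [recordBgField_zero F θ hk]
  show ‖(((1 : SU 2)) : MatA 2) - 1‖ ≤ 1 / 2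
  simp

open scoped Classical in
/-- **The two-block chart∘embedding AT THE ORIGIN decodes to print's (1.9) pair of the unit background** `(1 cut to X, J(1) cut to X)` — the `B = 0` instance of
`decodeCfg_recordChartJ_recordEmbJ`, unconditional. [cite: Balaban1987RG1, (1.9) p.261, (2.3) p.265] -/
theorem decodeCfg_recordChartJ_recordEmbJ_zero (θ : Stage13Params F 2) (Mc : ℕ) {k K : ℕ} (hk : k + 1 ≤ (F.P K).m + (F.P K).K)
    (X : (recordDomSys F Mc k K).Dom) :
    letI := θ.instVβ₁; letI := θ.instVβ₂
    decodeCfg F K (recordChartJ F Mc k K X (recordEmbJ F θ k K 0)) =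
      (fun b => if b ∈ domBonds F Mc k K X then ((recordBgField F θ k K 0 b : SU 2) : MatA 2) else 1,
       fun b => if b ∈ domBonds F Mc k K X then recordCurrent F θ k K 0 b else 0) := by
  letI := θ.instVβ₁; letI := θ.instVβ₂
  exact decodeCfg_recordChartJ_recordEmbJ F θ Mc k K X 0 fun b _ => norm_recordBgField_zero_sub_one F θ hk b

/-! ## §3  (v2 APPEND, porter gen 2) ROW S2-sel PART 2 — CONTINUITY AT THE UNIT FROM THE DISPLAYED [15] Prop. 9 TOKEN.  CRIT-1 RULING (B) + Q-4 (nodeO STATUS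
2026-08-30T23:34:39Z ∕ 23:39:39Z) put [15] Prop. 9's analyticity of `B ↦ U_{k+1}(W_B)` near `B = 0` into the antecedent of 27931⁷ ∕ 27930⁸ as the token TokP9-reg, whose BODY
(typer `TYPER-Sig27931-v7-tokens.txt`) is `AnalyticAt ℝ (fun B => fun b i i' => ((recordBgField F θ k K B b : SU 2) : Matrix (Fin 2) (Fin 2) ℂ) i i') 0` at
`θ := thetaFill F a₀ ε₂₉`, `K := recordK₀ F Mc k + n`.  From that SHAPE (stated here for any `θ`, `K`): continuity at `0`; with PART 1's VALUE `U_{k+1}(W_0) = 1`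
the smallness `‖U_{k+1}(W_B)_b − 1‖ ≤ ½` on EVERY fine bond EVENTUALLY near `B = 0`; hence the two-block chart∘embedding decodes to print's (1.9) pair cut to `X`
eventually, and row (f) of the (S1) mould follows from the (1.7)∕(1.9) identity ALONE (the `hU` hypothesis of `eventually_repr_recordChartJ_of_pairIdentity` discharged) -/

/-- **Continuity of `B ↦ U_{k+1}(W_B)_b` at `B = 0` from the TokP9-reg shape** (analyticity of the entries family ⟹ continuity ⟹ continuity of each bond's
matrix; the `L²`-operator-normed matrix space carries the product topology). [cite: Balaban1985Variational, Prop. 9 p.309; Balaban1987RG1, (2.3) p.265] -/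
theorem continuousAt_recordBgField_of_analyticAt (θ : Stage13Params F 2) (k K : ℕ)
    (hP9 : letI := θ.instVβ₁; letI := θ.instVβ₂
      AnalyticAt ℝ (fun B : Fin (F.P K).d → Site (F.P K) (k + 1) → θ.Vβ => fun (b : PBond (F.P K) 0) (i i' : Fin 2) =>
        ((recordBgField F θ k K B b : SU 2) : Matrix (Fin 2) (Fin 2) ℂ) i i') 0)
    (b : PBond (F.P K) 0) :
    letI := θ.instVβ₁; letI := θ.instVβ₂
    ContinuousAt (fun B : Fin (F.P K).d → Site (F.P K) (k + 1) → θ.Vβ => ((recordBgField F θ k K B b : SU 2) : MatA 2)) 0 := by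
  letI := θ.instVβ₁; letI := θ.instVβ₂
  exact (continuous_apply b).continuousAt.comp hP9.continuousAt

/-- **S2-sel PART 2 — THE SMALLNESS NEAR `B = 0`**: under the TokP9-reg shape and in the standing range `k + 1 ≤ m + K`, EVENTUALLY near `B = 0` every fine bond
variable of the rooted-gauge background field `U_{k+1}(W_B)` is within `½` of the unit (continuity at `0` + PART 1's `U_{k+1}(W_0) = 1`, finitely many bonds).
[cite: Balaban1985Variational, Thm 1 p.279, Prop. 9 p.309; Balaban1987RG1, (2.3) p.265, p.258] -/
theorem eventually_norm_recordBgField_sub_one_le (θ : Stage13Params F 2) {k K : ℕ} (hk : k + 1 ≤ (F.P K).m + (F.P K).K)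
    (hP9 : letI := θ.instVβ₁; letI := θ.instVβ₂
      AnalyticAt ℝ (fun B : Fin (F.P K).d → Site (F.P K) (k + 1) → θ.Vβ => fun (b : PBond (F.P K) 0) (i i' : Fin 2) =>
        ((recordBgField F θ k K B b : SU 2) : Matrix (Fin 2) (Fin 2) ℂ) i i') 0) :
    letI := θ.instVβ₁; letI := θ.instVβ₂
    ∀ᶠ B in 𝓝 (0 : Fin (F.P K).d → Site (F.P K) (k + 1) → θ.Vβ),
      ∀ b : PBond (F.P K) 0, ‖((recordBgField F θ k K B b : SU 2) : MatA 2) - 1‖ ≤ 1 / 2 := by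
  letI := θ.instVβ₁; letI := θ.instVβ₂
  refine Filter.eventually_all.mpr fun b => ?_
  have hc := continuousAt_recordBgField_of_analyticAt F θ k K hP9 b
  have h0 : ((recordBgField F θ k K (0 : Fin (F.P K).d → Site (F.P K) (k + 1) → θ.Vβ) b : SU 2) : MatA 2) = 1 := by
    rw [recordBgField_zero F θ hk]
    show (((1 : SU 2)) : MatA 2) = 1
    simp
  have hev := (Metric.tendsto_nhds.mp hc) (1 / 2) (by norm_num)
  filter_upwards [hev] with B hB
  rw [dist_eq_norm, h0] at hB
  exact hB.le

open scoped Classical in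
/-- **The two-block chart∘embedding decodes to PRINT's (1.9) pair cut to `X`, EVENTUALLY near `B = 0`** — `decodeCfg_recordChartJ_recordEmbJ` with its smallness
hypothesis discharged by the TokP9-reg shape (all `X` at once). [cite: Balaban1987RG1, (1.7), (1.8)–(1.9) p.261, (2.3) p.265; Balaban1985Variational, Prop. 9 p.309] -/
theorem eventually_decodeCfg_recordChartJ_recordEmbJ (θ : Stage13Params F 2) (Mc : ℕ) {k K : ℕ} (hk : k + 1 ≤ (F.P K).m + (F.P K).K)
    (hP9 : letI := θ.instVβ₁; letI := θ.instVβ₂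
      AnalyticAt ℝ (fun B : Fin (F.P K).d → Site (F.P K) (k + 1) → θ.Vβ => fun (b : PBond (F.P K) 0) (i i' : Fin 2) =>
        ((recordBgField F θ k K B b : SU 2) : Matrix (Fin 2) (Fin 2) ℂ) i i') 0) :
    letI := θ.instVβ₁; letI := θ.instVβ₂
    ∀ᶠ B in 𝓝 (0 : Fin (F.P K).d → Site (F.P K) (k + 1) → θ.Vβ), ∀ X : (recordDomSys F Mc k K).Dom,
      decodeCfg F K (recordChartJ F Mc k K X (recordEmbJ F θ k K B)) =
        (fun b => if b ∈ domBonds F Mc k K X then ((recordBgField F θ k K B b : SU 2) : MatA 2) else 1,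
         fun b => if b ∈ domBonds F Mc k K X then recordCurrent F θ k K B b else 0) := by
  letI := θ.instVβ₁; letI := θ.instVβ₂
  filter_upwards [eventually_norm_recordBgField_sub_one_le F θ hk hP9] with B hB X
  exact decodeCfg_recordChartJ_recordEmbJ F θ Mc k K X B fun b _ => hB b

open scoped Classical in
/-- **ROW (f) OF THE (S1) MOULD FROM PRINT's (1.7)∕(1.9) IDENTITY ALONE, under the TokP9-reg shape** (`k + 1 ≤ m + K`): if near `B = 0` the functional `Φ` IS the sum
over the catalogue of pieces ON PAIRS evaluated at `(U_{k+1}(W_B), J(U_{k+1}(W_B)))` cut to `X`, then near `B = 0`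
`Φ B = Σ_X Ep X (decodeCfg (recordChartJ X (recordEmbJ B)))` — hypothesis (f) of `formatPlusG_record_of_cpairRowsCtr` at `χ := recordChartJ`, `ι := recordEmbJ`.
[cite: Balaban1987RG1, (1.6)–(1.7) and (1.9) p.261; Balaban1985Variational, Prop. 9 p.309] -/
theorem eventually_repr_recordChartJ_of_pairIdentity_of_analyticAt (θ : Stage13Params F 2) (Mc : ℕ) {k K : ℕ} (hk : k + 1 ≤ (F.P K).m + (F.P K).K)
    (hP9 : letI := θ.instVβ₁; letI := θ.instVβ₂
      AnalyticAt ℝ (fun B : Fin (F.P K).d → Site (F.P K) (k + 1) → θ.Vβ => fun (b : PBond (F.P K) 0) (i i' : Fin 2) =>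
        ((recordBgField F θ k K B b : SU 2) : Matrix (Fin 2) (Fin 2) ℂ) i i') 0)
    (Φ : (Fin (F.P K).d → Site (F.P K) (k + 1) → θ.Vβ) → ℂ) (Ep : (recordDomSys F Mc k K).Dom → Sect2.CPair (F.P K) (MatA 2) → ℂ)
    (hΦ : letI := θ.instVβ₁; letI := θ.instVβ₂
      ∀ᶠ B in 𝓝 (0 : Fin (F.P K).d → Site (F.P K) (k + 1) → θ.Vβ), Φ B = ∑ X : (recordDomSys F Mc k K).Dom,
        Ep X (fun b => if b ∈ domBonds F Mc k K X then ((recordBgField F θ k K B b : SU 2) : MatA 2) else 1,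
              fun b => if b ∈ domBonds F Mc k K X then recordCurrent F θ k K B b else 0)) :
    letI := θ.instVβ₁; letI := θ.instVβ₂
    ∀ᶠ B in 𝓝 (0 : Fin (F.P K).d → Site (F.P K) (k + 1) → θ.Vβ),
      Φ B = ∑ X : (recordDomSys F Mc k K).Dom, Ep X (decodeCfg F K (recordChartJ F Mc k K X (recordEmbJ F θ k K B))) := by
  letI := θ.instVβ₁; letI := θ.instVβ₂
  exact eventually_repr_recordChartJ_of_pairIdentity F θ Mc k K id Φ Ep (eventually_norm_recordBgField_sub_one_le F θ hk hP9) hΦ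

/-- **The standing range holds at the texts' volumes**: `k + 1 ≤ (F.P (recordK₀ F Mc k + n)).m + (F.P (recordK₀ F Mc k + n)).K` for every `n` (the torus family has
`(F.P K).K = K`, and `recordK₀ F Mc k = k + 1 + log_L Mc ≥ k + 1`). [cite: Balaban1987RG1, (1.20)–(1.21) p.264 (bookkeeping)] -/
theorem succ_le_m_add_K_recordK₀ (Mc k n : ℕ) :
    k + 1 ≤ (F.P (recordK₀ F Mc k + n)).m + (F.P (recordK₀ F Mc k + n)).K := by
  have hK : (F.P (recordK₀ F Mc k + n)).K = recordK₀ F Mc k + n := F.P_K _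
  rw [hK, recordK₀]
  omega

/-- **AT THE TEXTS' LETTERS** (`θ := thetaFill F a₀ ε₂₉`, `K := recordK₀ F Mc k + n`): the TokP9-reg token's body at `(k, n, ε₂₉)` yields the eventual smallness on every
fine bond of `T_{recordK₀ + n}` — the form PART 1's docstring promised. [cite: Balaban1985Variational, Prop. 9 p.309; Balaban1987RG1, (2.3) p.265] -/
theorem eventually_norm_recordBgField_sub_one_le_at (a₀ ε₂₉ : ℝ) (Mc k n : ℕ)
    (hP9 : letI θ := thetaFill F a₀ ε₂₉; letI := θ.instVβ₁; letI := θ.instVβ₂; letI := θ.instιβ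
      AnalyticAt ℝ (fun B : recordW F a₀ ε₂₉ k (recordK₀ F Mc k + n) => fun (b : PBond (F.P (recordK₀ F Mc k + n)) 0) (i i' : Fin 2) =>
        ((recordBgField F θ k (recordK₀ F Mc k + n) B b : SU 2) : Matrix (Fin 2) (Fin 2) ℂ) i i') 0) :
    letI θ := thetaFill F a₀ ε₂₉; letI := θ.instVβ₁; letI := θ.instVβ₂; letI := θ.instιβ
    ∀ᶠ B in 𝓝 (0 : recordW F a₀ ε₂₉ k (recordK₀ F Mc k + n)),
      ∀ b : PBond (F.P (recordK₀ F Mc k + n)) 0, ‖((recordBgField F θ k (recordK₀ F Mc k + n) B b : SU 2) : MatA 2) - 1‖ ≤ 1 / 2 :=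
  eventually_norm_recordBgField_sub_one_le F (thetaFill F a₀ ε₂₉) (succ_le_m_add_K_recordK₀ F Mc k n) hP9

/-! ## §4  (v3 APPEND, porter gen 2) NEAR `B = 0` THE CHARTED CONFIGURATION `W_B` IS SMALL-FIELD, AND — UNDER THE DISPLAYED [15] Thm 1 TOKEN TokE — IT HAS A GENUINE,
UNIQUE MINIMAL ORBIT: `recordBgField B = U_{k+1}(W_B)` IS a minimiser over `W_B` (not the selector's junk default), EVENTUALLY near `0`.  At the record's fill
(`θ := thetaFill F a₀ ε₂₉`: `θ.Vβ = ℝ^{d(2)}`, `θ.ρ8 = suChartMap 2` — skew-Hermitian traceless values, so `W_B(b) = exp(ρ₈ B(b)) ∈ SU(2)` honestly, `θ.εbg = a₀`). -/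

/-- At the fill, `exp (ρ₈ v) ∈ SU(2)` (`ρ₈ = suChartMap 2` has values in 𝔰𝔲(2)). [cite: Balaban1987RG1, p.264 (before (1.20)); Hall2015, Example 7.3] -/
theorem exp_ρ8_thetaFill_mem (a₀ ε₂₉ : ℝ) (v : (thetaFill F a₀ ε₂₉).Vβ) :
    letI θ := thetaFill F a₀ ε₂₉; letI := θ.instVβ₁; letI := θ.instVβ₂
    exp (θ.ρ8 v) ∈ Matrix.specialUnitaryGroup (Fin 2) ℂ := by
  letI θ := thetaFill F a₀ ε₂₉; letI := θ.instVβ₁; letI := θ.instVβ₂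
  have hρ : (θ.ρ8 : θ.Vβ → Matrix (Fin 2) (Fin 2) ℂ) = (suChartMap 2 : (Fin (suChartDim 2) → ℝ) → Matrix (Fin 2) (Fin 2) ℂ) := rfl
  have h := suChartMap_mem 2 v
  have hv : θ.ρ8 v = suChartMap 2 v := congrFun hρ v
  rw [hv]
  exact T4AdjointCovarianceUnitary.exp_mem_specialUnitaryGroup_of_mem_lieSU
    (T4AdjointCovarianceUnitary.mem_lieSU_iff.mpr ⟨by rw [Matrix.star_eq_conjTranspose]; exact h.1, h.2⟩)

/-- **`W_B(b) = exp(ρ₈ B(b))` as a matrix, at the fill** (the retraction `suOfMat` is the identity on `SU(2)`). [cite: Balaban1987RG1, p.264 (before (1.20))] -/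
theorem coe_unitField_thetaFill (a₀ ε₂₉ : ℝ) (k K : ℕ) (B : recordW F a₀ ε₂₉ k K) (b : PBond (F.P K) (k + 1)) :
    letI θ := thetaFill F a₀ ε₂₉; letI := θ.instVβ₁; letI := θ.instVβ₂
    ((unitField F θ k K B b : SU 2) : MatA 2) = exp (θ.ρ8 (B b.dir b.src)) := by
  letI θ := thetaFill F a₀ ε₂₉; letI := θ.instVβ₁; letI := θ.instVβ₂
  have h : unitField F θ k K B b = suOfMat 2 (exp (θ.ρ8 (B b.dir b.src))) := rfl
  rw [h, suOfMat_of_mem (exp_ρ8_thetaFill_mem F a₀ ε₂₉ (B b.dir b.src))]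

/-- **`B ↦ W_B` is continuous** at the fill (bondwise `exp ∘ ρ₈ ∘ eval`, through the subtype topology of `SU(2)`). [cite: Balaban1987RG1, p.264 (before (1.20)) (bookkeeping)] -/
theorem continuous_unitField_thetaFill (a₀ ε₂₉ : ℝ) (k K : ℕ) :
    letI θ := thetaFill F a₀ ε₂₉; letI := θ.instVβ₁; letI := θ.instVβ₂
    Continuous (fun B : recordW F a₀ ε₂₉ k K => unitField F θ k K B) := by
  letI θ := thetaFill F a₀ ε₂₉; letI := θ.instVβ₁; letI := θ.instVβ₂
  refine continuous_pi fun b => ?_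
  refine Topology.IsInducing.subtypeVal.continuous_iff.mpr ?_
  have h1 : Continuous fun B : recordW F a₀ ε₂₉ k K => B b.dir b.src :=
    (continuous_apply b.src).comp (continuous_apply (A := fun _ : Fin (F.P K).d => Site (F.P K) (k + 1) → θ.Vβ) b.dir)
  have h2 : Continuous fun B : recordW F a₀ ε₂₉ k K => θ.ρ8 (B b.dir b.src) := θ.ρ8.continuous.comp h1
  have hexp : Continuous (exp : MatA 2 → MatA 2) :=
    continuous_iff_continuousAt.2 fun x => (NormedSpace.exp_analytic (𝕂 := ℂ) x).continuousAt
  have h3 : Continuous fun B : recordW F a₀ ε₂₉ k K => exp (θ.ρ8 (B b.dir b.src)) := hexp.comp h2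
  exact h3.congr fun B => (coe_unitField_thetaFill F a₀ ε₂₉ k K B b).symm

/-- **NEAR `B = 0` THE CHARTED CONFIGURATION IS SMALL-FIELD**: for every `ε₁ > 0`, eventually `|W_B(∂p) − 1| < ε₁` on all plaquettes (`W_0 = 1`, continuity, finitely many strict
inequalities). [cite: Balaban1987RG1, (1.2) p.260, p.265 («W is so regular that the minimal configurations U_{k+1}(W) exist»)] -/
theorem eventually_plaqSmall_unitField (a₀ ε₂₉ : ℝ) (k K : ℕ) {ε₁ : ℝ} (hε₁ : 0 < ε₁) :
    letI θ := thetaFill F a₀ ε₂₉; letI := θ.instVβ₁; letI := θ.instVβ₂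
    ∀ᶠ B in 𝓝 (0 : recordW F a₀ ε₂₉ k K), PlaqSmall ε₁ (unitField F θ k K B) := by
  letI θ := thetaFill F a₀ ε₂₉; letI := θ.instVβ₁; letI := θ.instVβ₂
  have hopen : IsOpen {U : GaugeField (F.P K) (k + 1) (SU 2) | PlaqSmall ε₁ U} := by
    have h : {U : GaugeField (F.P K) (k + 1) (SU 2) | PlaqSmall ε₁ U} = ⋂ p : Plaq (F.P K) (k + 1), {U | dist1 (GaugeField.plaqHol U p) < ε₁} := by
      ext U; simp [PlaqSmall]
    rw [h]
    exact isOpen_iInter_of_finite fun p =>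
      isOpen_lt (B12ContinuousTransportInvarianceOn.continuous_dist1_SU.comp (B12ContinuousTransportInvarianceOn.continuous_plaqHol_SU p)) continuous_const
  have h0 : PlaqSmall ε₁ (unitField F θ k K (0 : recordW F a₀ ε₂₉ k K)) := by
    rw [unitField_zero F θ k K]
    intro p
    rw [B15Chi124DetSets.plaqHol_one, GaugeGroup.dist1_one]
    exact hε₁
  exact (continuous_unitField_thetaFill F a₀ ε₂₉ k K).continuousAt.preimage_mem_nhds (hopen.mem_nhds h0)

/-- ★ **UNDER TokE, NEAR `B = 0` THE ROOTED BACKGROUND IS A GENUINE MINIMISER OVER `W_B` AND THE MINIMAL ORBIT IS UNIQUE**: with the [15] Thm 1 token in its displayed shape at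
one `ε₁ > 0` (`PlaqSmall ε₁ V → UkExists … a₀ V ∧ UniqueUkOrbit … a₀ V` on `T_K` at level `k + 1`), eventually `IsBackground … (W_B) (U_{k+1}(W_B))` and `UniqueUkOrbit … (W_B)`
(the selector's documented contract `isBackground_UkSel` on `UkExists`; `θ.εbg = a₀`). [cite: Balaban1985Variational, Thm 1 p.279; Balaban1987RG1, (0.21) p.256, (2.3) p.265] -/
theorem eventually_isBackground_recordBgField_of_tokE (a₀ ε₂₉ : ℝ) {k K : ℕ} (hk : k + 1 ≤ (F.P K).m + (F.P K).K) {ε₁ : ℝ} (hε₁ : 0 < ε₁)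
    (hTokE : ∀ V : GaugeField (F.P K) (k + 1) (SU 2), PlaqSmall ε₁ V → UkExists F 2 K (k + 1) a₀ V ∧ UniqueUkOrbit F 2 K (k + 1) a₀ V) :
    letI θ := thetaFill F a₀ ε₂₉; letI := θ.instVβ₁; letI := θ.instVβ₂
    ∀ᶠ B in 𝓝 (0 : recordW F a₀ ε₂₉ k K),
      IsBackground (avOfRecord F 2 K) (bgReg F 2 K (k + 1) a₀) (k + 1) (unitField F θ k K B) (recordBgField F θ k K B) ∧
        UniqueUkOrbit F 2 K (k + 1) a₀ (unitField F θ k K B) := by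
  letI θ := thetaFill F a₀ ε₂₉; letI := θ.instVβ₁; letI := θ.instVβ₂
  filter_upwards [eventually_plaqSmall_unitField F a₀ ε₂₉ k K hε₁] with B hB
  obtain ⟨hE, hU⟩ := hTokE _ hB
  exact ⟨isBackground_UkSel hk hE, hU⟩

end Summit.QuantumFields.YangMills.Theorems.BalabanUVNodesPortS1

end
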